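import Literature.InformationTheory.Entanglement.GHZFidelityWitness
import Literature.InformationTheory.Entanglement.MerminKlyshkoInequality
import HarnessLib

/-!
# GHZ states saturate the Mermin–Klyshko quantum value `2^{(n−1)/2}` with `σ_x / σ_y` settings

Topic `Literature/InformationTheory/Entanglement`, the QUANTUM side of
`MerminKlyshkoInequality.lean` (whose `mermin_klyshko_inequality` is the local bound
`|⟨𝓑_n⟩|_LHV ≤ 1`), on the `N`-qubit register of `GHZFidelityWitness.lean` (`ket`, `ghzN`, the
phase family `ghzPhase N c = (|0…0⟩ + c|1…1⟩)/√2`).  Sources (held texts, read at the cited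
places):

* A. Cabello, Phys. Rev. A 65, 062105 (2002) = arXiv:quant-ph/0202126 [Cabello2002nSpinS], §III:
  “the quantum correlation of `A₁, …, A_n` is defined as `⟨ψ| Â₁ ⊗ ⋯ ⊗ Â_n |ψ⟩`”; eq. (9)–(10):
  “The greatest eigenvalue of `M̂_n` is `2^{3(n−1)/2} sⁿ`, which is nondegenerated. … For
  `n ≥ 3`, `|μ_n⟩` is a generalized GHZ state … according to quantum mechanics the expected value
  for `M_n` in the state `|μ_n⟩` is given by `⟨μ_n|M̂_n|μ_n⟩ = 2^{3(n−1)/2} sⁿ`. This value violates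
  inequality (6)” (here `s = 1`, `M_n = 2^{n−1}𝓑_n`, so `⟨𝓑_n⟩ = 2^{(n−1)/2}`); “for `n` odd … `M̂_n`
  is a linear combination with coefficients `±2^{(n−1)/2}` of `2^{n−1}` operators”.
* S. Kanno, J. Soda, Phys. Rev. D 96, 083501 (2017) = arXiv:1705.06199 [KannoSoda2017], §2.2
  eq. (2.9): “In quantum mechanics, this inequality is violated … `|⟨𝓑_n⟩| ≤ 2^{(n−1)/2}`,
  `n = 1, 2, 3, ⋯`. Thus, in quantum mechanics, the upper bound can be exponentially bigger for
  multipartite states (`n > 2`)”.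
* D. Alsina, J. I. Latorre, Phys. Rev. A 94, 012314 (2016) = arXiv:1605.04220
  [AlsinaLatorre2016], §II: “for quantum mechanics (QM) the observables `a_i` and `a′_i` are built
  out of linear combinations of Pauli matrices. Each measurement is expressed as a Kronecker
  product of the three local measurements … the quantum bound, is `⟨M₃⟩^{QM} ≤ 4`”; “a quantum
  bound of `⟨M₄⟩^{QM} ≤ 8√2`”; “a quantum bound of `⟨M₅⟩^{QM} ≤ 16`”; §I: “Such inequalities
  should be maximally violated by GHZ-type states”; §III (Circuit implementation): “In the test
  of Mermin inequalitites, only GHZ-like states have to be created. … In our choice of settings,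
  the needed GHZ-like states have relative phases, as in the case of 3-qubits, where
  `|φ⟩ = 1/√2(|000⟩ + i|111⟩)`. … In our choice of settings, the number of primes amounts to the
  number of `σ_y` measurements, whereas the non primes (`a_i`) correspond to `σ_x` measurements”
  (for `N = 3` our optimal phase `((1+i)/√2)² = i` is exactly this state).
* R. Bertlmann, N. Friis, *Modern Quantum Theory* (2023) [BertlmannFriis2023], §18.2 eq. (18.13)
  (the local spin operators as tensor factors, `X₁ = σ_x ⊗ 𝟙 ⊗ 𝟙`, …).

HONEST FRAMING (pub-qadeq lane — multi-qubit Mermin tests and `N`-qubit GHZ ‘nonlocality’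
milestones): instance-level adjudication of specific advantage claims; no claim about BQP vs
BPP or the summit.  This file computes the quantum-mechanical target value for every `N`;
nothing here concerns devices or statistics.

## Contents (all proved, 0 named facts)

* **`pauliWord w`** — a Pauli string `⊗_j σ_{w_j}` on the register `Fin N → Bool`, as the matrix
  whose entries are the products of the one-qubit entries (`Pauli.mat`); `pauliWord_mul_self`
  (`= 𝟙`: dichotomic `±1` observables), `pauliWord_isHermitian`; **`obsWord s`** — the
  `σ_x / σ_y` string of a setting word (`s j = false ↦ σ_x`, `true ↦ σ_y`); its action on
  `|b…b⟩`: **`obsWord_mulVec_ket`**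
  (`O_s|0…0⟩ = (∏_{s_j = y} i)|1…1⟩`, `O_s|1…1⟩ = (∏_{s_j = y} (−i))|0…0⟩`).
* **`expect_obsWord_ghzPhase`** — the quantum correlators
  `⟨GHZ_N^c| O_s |GHZ_N^c⟩ = Re(c̄ · i^{#y(s)})` (`N ≥ 1`).
* The complex evaluation of the Mermin–Klyshko polynomial: **`mkSumC n α β`**
  `= Σ_s c_n(s) Π_j (s_j ? β : α)` with the recursion **`mkSumC_succ`** (the printed (2.6)) and
  the closed forms **`mkSumC_one_I`** (`𝓑_{n+1}(1, i) = (1 + i)ⁿ`) and `mkSumC_I_one`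
  (`𝓑_{n+1}(i, 1) = i^{n+1}(1 − i)ⁿ`).
* **`mk_expect_ghzPhase`** — `⟨𝓑_{n+1}⟩_{GHZ^c, σ_x/σ_y} = Σ_s c_{n+1}(s)⟨O_s⟩ = Re(c̄ (1+i)ⁿ)`;
  **`mk_expect_ghzOpt`** — with the phase `c = ((1+i)/√2)ⁿ` the value is exactly
  `(√2)ⁿ = 2^{((n+1)−1)/2}`, the quantum bound (2.9) / Cabello's (10) at `s = 1`
  (`sqrt_two_pow_gt_one`: it exceeds the LHV bound `1` of `mermin_klyshko_inequality` for every
  `n ≥ 1`, by the factor `2^{n/2}`); the printed quantum bounds of [AlsinaLatorre2016] are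
  attained: **`alsinaLatorre_quantum_M3`** (`2·2 = 4`), **`alsinaLatorre_quantum_M4`**
  (`4·2√2 = 8√2`), **`alsinaLatorre_quantum_M5`** (`4·4 = 16`).

NOT formalised: that `2^{(n−1)/2}` is the maximum over ALL quantum strategies (Tsirelson-type
bound (2.9) / Werner–Wolf), optimal settings for the un-phased `|GHZ_N⟩`, the spin-`s` case.

## Mathlib / tree search

Mathlib has binary `Matrix.kroneckerMap` only; the `N`-fold product observable is written
entrywise (product of one-qubit entries — the Kronecker rule), with `O_s² = 𝟙` proved from
`Finset.prod_univ_sum`.  Tree: `Pauli.mat` (`PauliExpansion.lean`), `vecState`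
(`TsirelsonBound.lean`), `GHZWitness.ket` / `ghzPhase` / `star_ghzPhase_dotProduct`
(`GHZFidelityWitness.lean`), `MerminKlyshko.mkCoeff` / `mkCoeff_snoc_true` / `mkCoeff_snoc_false`
(`MerminKlyshkoInequality.lean`); `GHZMermin.lean` has the `N = 3` values on a different index
type (`mermin_eigen_ghzPlus`: `XYY + YXY + YYX − XXX = −4` on `|GHZ⁺⟩`, consistent with
`Re(i³(1−i)²) = −2 = 𝓑₃` here).
-/

namespace Literature.InformationTheory.Entanglement

namespace MerminKlyshkoGHZ

open Matrix Complex Finset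
open Literature.Computability.QuantumComplexity
open Literature.InformationTheory.Entanglement.Tsirelson
open GHZWitness MerminKlyshko

variable {N : ℕ}

/-! ## Product observables `⊗_j σ^{(s_j)}` on the `N`-qubit register -/

/-- The one-qubit setting: `false ↦ σ_x` (unprimed `a_i = 𝒪_i`), `true ↦ σ_y` (primed `a′_i = 𝒪′_i`)
— “the number of primes amounts to the number of `σ_y` measurements, whereas the non primes
(`a_i`) correspond to `σ_x` measurements”. [cite: AlsinaLatorre2016, §III] -/
def settingPauli (t : Bool) : Pauli := if t then Pauli.Y else Pauli.X

/-- A Pauli string `⊗_j σ_{w_j}` (`w : Fin N → Pauli`) on the register `Fin N → Bool`, as the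
matrix whose entries are the products of the one-qubit entries (the Kronecker rule, “each
measurement is expressed as a Kronecker product of the … local measurements”; the local
operators `X₁ = σ_x ⊗ 𝟙 ⊗ 𝟙`, … of (18.13)). [cite: AlsinaLatorre2016, §II; BertlmannFriis2023,
§18.2 eq. (18.13)] -/
noncomputable def pauliWord (w : Fin N → Pauli) : Matrix (Fin N → Bool) (Fin N → Bool) ℂ :=
  Matrix.of fun x y => ∏ j, (w j).mat (x j) (y j)

/-- Unfolding `pauliWord`. [cite: AlsinaLatorre2016, §II] -/
theorem pauliWord_apply (w : Fin N → Pauli) (x y : Fin N → Bool) :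
    pauliWord w x y = ∏ j, (w j).mat (x j) (y j) := rfl

/-- A Pauli string is Hermitian (each `σ` is). [cite: Cabello2002nSpinS, §III (“self-adjoint
operators that represent the local observables”)] -/
theorem pauliWord_isHermitian (w : Fin N → Pauli) : (pauliWord w).IsHermitian := by
  refine Matrix.IsHermitian.ext fun x y => ?_
  rw [pauliWord_apply, pauliWord_apply, star_prod]
  refine Finset.prod_congr rfl fun j _ => ?_
  have h := congrFun (congrFun (Pauli.conjTranspose_mat (w j)) (x j)) (y j)
  rw [conjTranspose_apply] at h
  exact h

/-- `(⊗_j σ_{w_j})² = 𝟙`: a Pauli string is a dichotomic (`±1`-valued) observable, as the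
local-realistic values `±1` presuppose. [cite: Cabello2002nSpinS, §II–§III (“observables taking
values −1 or 1”)] -/
theorem pauliWord_mul_self (w : Fin N → Pauli) : pauliWord w * pauliWord w = 1 := by
  ext x z
  rw [Matrix.mul_apply]
  simp only [pauliWord_apply]
  -- `Σ_y Π_j σ(x_j,y_j) σ(y_j,z_j) = Π_j Σ_b σ(x_j,b) σ(b,z_j) = Π_j (σ²)(x_j,z_j) = δ_{xz}`
  have h : ∀ y : Fin N → Bool, (∏ j, (w j).mat (x j) (y j)) * (∏ j, (w j).mat (y j) (z j)) =
      ∏ j, (w j).mat (x j) (y j) * (w j).mat (y j) (z j) :=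
    fun y => (Finset.prod_mul_distrib).symm
  simp_rw [h]
  rw [← Fintype.piFinset_univ, ← Finset.prod_univ_sum (fun _ => (Finset.univ : Finset Bool))
    (fun j b => (w j).mat (x j) b * (w j).mat b (z j))]
  have hsq : ∀ j, ∑ b, (w j).mat (x j) b * (w j).mat b (z j) = if x j = z j then 1 else 0 := by
    intro j
    have := congrFun (congrFun (Pauli.mat_mul_self (w j)) (x j)) (z j)
    rw [Matrix.mul_apply, Matrix.one_apply] at this
    exact this
  simp_rw [hsq]
  rw [Matrix.one_apply]
  by_cases hxz : x = z
  · subst hxz; simp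
  · rw [if_neg hxz]
    have : ∃ j, x j ≠ z j := by
      by_contra hall
      push Not at hall
      exact hxz (funext hall)
    obtain ⟨j, hj⟩ := this
    exact Finset.prod_eq_zero (Finset.mem_univ j) (if_neg hj)

/-- The product observable `O_s = ⊗_j σ^{(s_j)}` for a setting word `s : Fin N → Bool`
(`σ_x` where `s_j = false`, `σ_y` where `s_j = true`). [cite: AlsinaLatorre2016, §II–§III] -/
noncomputable def obsWord (s : Fin N → Bool) : Matrix (Fin N → Bool) (Fin N → Bool) ℂ :=
  pauliWord fun j => settingPauli (s j)

/-- Unfolding `obsWord`. [cite: AlsinaLatorre2016, §II] -/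
theorem obsWord_apply (s : Fin N → Bool) (x y : Fin N → Bool) :
    obsWord s x y = ∏ j, (settingPauli (s j)).mat (x j) (y j) := rfl

/-- `O_s` is Hermitian. [cite: Cabello2002nSpinS, §III] -/
theorem obsWord_isHermitian (s : Fin N → Bool) : (obsWord s).IsHermitian :=
  pauliWord_isHermitian _

/-- `O_s² = 𝟙`. [cite: Cabello2002nSpinS, §II–§III] -/
theorem obsWord_mul_self (s : Fin N → Bool) : obsWord s * obsWord s = 1 :=
  pauliWord_mul_self _

/-- The one-qubit entries `σ(b̄, b)`: `σ_x(b̄,b) = 1`, `σ_y(1,0) = i`, `σ_y(0,1) = −i`. [folklore] -/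
private theorem settingPauli_mat_not (t b : Bool) :
    (settingPauli t).mat (!b) b = if t then (if b then -I else I) else 1 := by
  cases t <;> cases b <;> simp [settingPauli]

/-- The one-qubit diagonal entries vanish: `σ_x(b,b) = σ_y(b,b) = 0`. [folklore] -/
private theorem settingPauli_mat_self (t b : Bool) : (settingPauli t).mat b b = 0 := by
  cases t <;> cases b <;> simp [settingPauli]

/-- The complex evaluation of a setting word: `Π_j (s_j ? β : α)`. [cite: KannoSoda2017, §2.2 eq.
(2.6)] -/
noncomputable def wordEvalC (s : Fin N → Bool) (α β : ℂ) : ℂ := ∏ j, (if s j then β else α)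

/-- `Π_j (s_j ? i : 1) = i^{#y(s)}`: the phase collected by a `σ_x/σ_y` word on `|0…0⟩` is `i` per
`σ_y` letter (“the number of primes amounts to the number of `σ_y` measurements”).
[cite: AlsinaLatorre2016, §III] -/
theorem wordEvalC_one_I (s : Fin N → Bool) :
    wordEvalC s 1 I = I ^ (Finset.univ.filter fun j => s j = true).card := by
  unfold wordEvalC
  rw [Finset.prod_ite, Finset.prod_const_one, mul_one, Finset.prod_const]

/-- **The action of `O_s` on `|b…b⟩`**: every `σ_x`/`σ_y` flips the bit, `σ_y` contributes the
phase `i` on `|0⟩` and `−i` on `|1⟩`; so `O_s|0…0⟩ = i^{#y}|1…1⟩` and `O_s|1…1⟩ = (−i)^{#y}|0…0⟩`.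
[cite: BertlmannFriis2023, §18.2 eq. (18.13); AlsinaLatorre2016, §II] -/
theorem obsWord_mulVec_ket (s : Fin N → Bool) (b : Bool) :
    obsWord s *ᵥ ket (constLabel N b) =
      wordEvalC s 1 (if b then -I else I) • ket (constLabel N (!b)) := by
  ext x
  rw [ket, Matrix.mulVec_single_one, Pi.smul_apply, smul_eq_mul]
  change obsWord s x (constLabel N b) = _
  rw [obsWord_apply, ket_apply]
  by_cases hx : x = constLabel N (!b)
  · subst hx
    rw [if_pos rfl, mul_one, wordEvalC]
    refine Finset.prod_congr rfl fun j _ => ?_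
    rw [constLabel_apply, constLabel_apply, settingPauli_mat_not]
  · rw [if_neg hx, mul_zero]
    have : ∃ j, x j = b := by
      by_contra hall
      push Not at hall
      apply hx
      funext j
      rw [constLabel_apply]
      cases hb : x j <;> cases b <;> simp_all
    obtain ⟨j, hj⟩ := this
    refine Finset.prod_eq_zero (Finset.mem_univ j) ?_
    rw [hj, constLabel_apply, settingPauli_mat_self]

/-- `Π_j (s_j ? −i : 1)` is the conjugate of `Π_j (s_j ? i : 1)`. [folklore] -/
private theorem wordEvalC_one_negI (s : Fin N → Bool) :
    wordEvalC s 1 (-I) = star (wordEvalC s 1 I) := by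
  unfold wordEvalC
  rw [star_prod]
  refine Finset.prod_congr rfl fun j _ => ?_
  cases s j <;> simp [Complex.conj_I]

/-- `(1/√2)·(1/√2) = 1/2` in `ℂ`. [folklore] -/
private theorem invSqrtTwo_mul_self_C :
    (CHSHOpt.invSqrtTwo : ℂ) * (CHSHOpt.invSqrtTwo : ℂ) = 1 / 2 := by
  rw [← Complex.ofReal_mul, CHSHOpt.invSqrtTwo_mul_self]; push_cast; ring

/-- **The GHZ correlators**: for `N ≥ 1` and any `c`,
`Re⟨GHZ_N^c| O_s |GHZ_N^c⟩ = Re(c̄ · Π_j (s_j ? i : 1)) = Re(c̄ i^{#y(s)})`.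
[cite: Cabello2002nSpinS, §III (quantum correlation `⟨ψ|Â₁ ⊗ ⋯ ⊗ Â_n|ψ⟩`); AlsinaLatorre2016,
§III (Circuit implementation)] -/
theorem expect_obsWord_ghzPhase [NeZero N] (c : ℂ) (s : Fin N → Bool) :
    vecState (ghzPhase N c) (obsWord s) = (star c * wordEvalC s 1 I).re := by
  have hne := constLabel_false_ne_true (N := N)
  have hmv : obsWord s *ᵥ ghzPhase N c =
      (CHSHOpt.invSqrtTwo : ℂ) • (wordEvalC s 1 I • ket (constLabel N true) +
        (c * wordEvalC s 1 (-I)) • ket (constLabel N false)) := by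
    rw [ghzPhase, mulVec_smul, mulVec_add, mulVec_smul, obsWord_mulVec_ket, obsWord_mulVec_ket]
    simp only [Bool.false_eq_true, if_false, if_true, Bool.not_false, Bool.not_true, smul_smul]
  have key : star (ghzPhase N c) ⬝ᵥ (obsWord s *ᵥ ghzPhase N c) =
      ((1 / 2 : ℝ) : ℂ) * (star (star c * wordEvalC s 1 I) + star c * wordEvalC s 1 I) := by
    rw [hmv, dotProduct_smul, star_ghzPhase_dotProduct, smul_eq_mul]
    simp only [Pi.add_apply, Pi.smul_apply, smul_eq_mul, ket_self, ket_of_ne hne,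
      ket_of_ne (Ne.symm hne), mul_one, mul_zero, add_zero, zero_add]
    rw [wordEvalC_one_negI, star_mul', star_star]
    push_cast
    linear_combination (c * star (wordEvalC s 1 I) + star c * wordEvalC s 1 I) *
      invSqrtTwo_mul_self_C
  rw [vecState_apply, key, Complex.re_ofReal_mul, Complex.add_re, Complex.star_def,
    Complex.conj_re]
  ring

/-- With `#y(s)` explicit: `Re⟨GHZ_N^c| O_s |GHZ_N^c⟩ = Re(c̄ · i^{#y(s)})`.
[cite: Cabello2002nSpinS, §III; AlsinaLatorre2016, §III] -/
theorem expect_obsWord_ghzPhase_pow [NeZero N] (c : ℂ) (s : Fin N → Bool) :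
    vecState (ghzPhase N c) (obsWord s) =
      (star c * I ^ (Finset.univ.filter fun j => s j = true).card).re := by
  rw [expect_obsWord_ghzPhase, wordEvalC_one_I]

/-! ## The Mermin–Klyshko polynomial over `ℂ` and its value at `(1, i)` -/

/-- The Mermin–Klyshko polynomial evaluated at complex arguments (constant per setting):
`𝓑_n(α, β) = Σ_s c_n(s) Π_j (s_j ? β : α)`. [cite: KannoSoda2017, §2.2 eq. (2.6)] -/
noncomputable def mkSumC (n : ℕ) (α β : ℂ) : ℂ :=
  ∑ s : Fin n → Bool, (mkCoeff n s : ℂ) * wordEvalC s α β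

/-- `𝓑₀ = 1`. [cite: KannoSoda2017, §2.2 eq. (2.6)] -/
theorem mkSumC_zero (α β : ℂ) : mkSumC 0 α β = 1 := by
  simp [mkSumC, wordEvalC, mkCoeff]

/-- Letter flip on setting words. [folklore] -/
private def flipEquiv (n : ℕ) : (Fin n → Bool) ≃ (Fin n → Bool) :=
  Function.Involutive.toPerm (fun s i => !s i) fun s => funext fun i => Bool.not_not (s i)

/-- Flipping every letter exchanges `α` and `β`. [folklore] -/
private theorem wordEvalC_flip {n : ℕ} (s : Fin n → Bool) (α β : ℂ) :
    wordEvalC (fun i => !s i) α β = wordEvalC s β α := by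
  unfold wordEvalC
  refine Finset.prod_congr rfl fun i _ => ?_
  cases h : s i <;> simp [h]

/-- Splitting off a last letter `𝒪′`. [folklore] -/
private theorem wordEvalC_snoc_true {n : ℕ} (s : Fin n → Bool) (α β : ℂ) :
    wordEvalC (Fin.snoc s true) α β = wordEvalC s α β * β := by
  unfold wordEvalC
  rw [Fin.prod_univ_castSucc]
  simp only [Fin.snoc_castSucc, Fin.snoc_last, if_true]

/-- Splitting off a last letter `𝒪`. [folklore] -/
private theorem wordEvalC_snoc_false {n : ℕ} (s : Fin n → Bool) (α β : ℂ) :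
    wordEvalC (Fin.snoc s false) α β = wordEvalC s α β * α := by
  unfold wordEvalC
  rw [Fin.prod_univ_castSucc]
  simp only [Fin.snoc_castSucc, Fin.snoc_last, Bool.false_eq_true, if_false]

/-- `Fin.snocEquiv` appends the letter. [folklore] -/
private theorem snocEquiv_apply' {n : ℕ} (t : Bool) (s : Fin n → Bool) :
    (Fin.snocEquiv fun _ => Bool) (t, s) = Fin.snoc s t := rfl

/-- **The printed recursion over `ℂ`**: `𝓑_{n+1}(α,β) = ½(α+β)𝓑_n(α,β) + ½(α−β)𝓑_n(β,α)`.
[cite: KannoSoda2017, §2.2 eq. (2.6)] -/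
theorem mkSumC_succ (n : ℕ) (α β : ℂ) :
    mkSumC (n + 1) α β =
      1 / 2 * (α + β) * mkSumC n α β + 1 / 2 * (α - β) * mkSumC n β α := by
  have hflip : mkSumC n β α =
      ∑ s : Fin n → Bool, (mkCoeff n (fun i => !s i) : ℂ) * wordEvalC s α β := by
    unfold mkSumC
    rw [← (flipEquiv n).sum_comp]
    refine Finset.sum_congr rfl fun s _ => ?_
    have h : (flipEquiv n s : Fin n → Bool) = fun i => !s i := rfl
    rw [h, wordEvalC_flip]
  rw [hflip]
  unfold mkSumC
  rw [← (Fin.snocEquiv fun _ => Bool).sum_comp, Fintype.sum_prod_type, Fintype.sum_bool]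
  simp only [snocEquiv_apply', wordEvalC_snoc_true, wordEvalC_snoc_false, mkCoeff_snoc_true,
    mkCoeff_snoc_false]
  rw [Finset.mul_sum, Finset.mul_sum, ← Finset.sum_add_distrib, ← Finset.sum_add_distrib]
  refine Finset.sum_congr rfl fun s _ => ?_
  push_cast
  ring

/-- `i(1 − i) = 1 + i`. [folklore] -/
private theorem I_mul_one_sub_I : I * (1 - I) = 1 + I := by
  linear_combination (-1 : ℂ) * Complex.I_sq

/-- **Closed form**: `𝓑_{n+1}(1, i) = (1 + i)ⁿ` and `𝓑_{n+1}(i, 1) = i^{n+1}(1 − i)ⁿ` — the complex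
numbers whose real parts (times a phase) are the GHZ values of `𝓑_{n+1}` and `𝓑′_{n+1}`.
[cite: Cabello2002nSpinS, §III eq. (10) (the value `2^{3(n−1)/2}sⁿ`, i.e. `|𝓑_n| = 2^{(n−1)/2}`)] -/
theorem mkSumC_closed (n : ℕ) :
    mkSumC (n + 1) 1 I = (1 + I) ^ n ∧ mkSumC (n + 1) I 1 = I ^ (n + 1) * (1 - I) ^ n := by
  induction n with
  | zero =>
    rw [mkSumC_succ, mkSumC_zero, mkSumC_zero]
    rw [mkSumC_succ, mkSumC_zero, mkSumC_zero]
    constructor <;> ring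
  | succ n ih =>
    obtain ⟨h1, h2⟩ := ih
    have hpow : (1 + I) ^ n = I ^ n * (1 - I) ^ n := by rw [← mul_pow, I_mul_one_sub_I]
    constructor
    · have e : I ^ (n + 1) * (1 - I) ^ n = I * (1 + I) ^ n := by
        rw [pow_succ', mul_assoc, ← hpow]
      rw [mkSumC_succ, h1, h2, e]
      linear_combination (-(1 / 2) * (1 + I) ^ n) * Complex.I_sq
    · rw [mkSumC_succ, h1, h2, hpow]
      linear_combination (I ^ n * (1 - I) ^ n * (I - 1 / 2)) * Complex.I_sq

/-- `𝓑_{n+1}(1, i) = (1 + i)ⁿ`. [cite: Cabello2002nSpinS, §III eq. (10)] -/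
theorem mkSumC_one_I (n : ℕ) : mkSumC (n + 1) 1 I = (1 + I) ^ n := (mkSumC_closed n).1

/-- `𝓑_{n+1}(i, 1) = i^{n+1}(1 − i)ⁿ`. [cite: Cabello2002nSpinS, §III eq. (10)] -/
theorem mkSumC_I_one (n : ℕ) : mkSumC (n + 1) I 1 = I ^ (n + 1) * (1 - I) ^ n :=
  (mkSumC_closed n).2

/-! ## The Mermin–Klyshko value of `|GHZ^c⟩` with `σ_x / σ_y` settings -/

/-- **`⟨𝓑_{n+1}⟩` on the GHZ family**: with `𝒪_j = σ_x`, `𝒪′_j = σ_y` on every qubit,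
`Σ_s c_{n+1}(s) ⟨GHZ^c| O_s |GHZ^c⟩ = Re(c̄ (1 + i)ⁿ)`. [cite: Cabello2002nSpinS, §III eq. (10);
AlsinaLatorre2016, §III (“the needed GHZ-like states have relative phases”)] -/
theorem mk_expect_ghzPhase (n : ℕ) (c : ℂ) :
    ∑ s : Fin (n + 1) → Bool, mkCoeff (n + 1) s * vecState (ghzPhase (n + 1) c) (obsWord s) =
      (star c * (1 + I) ^ n).re := by
  simp_rw [expect_obsWord_ghzPhase]
  rw [← mkSumC_one_I, mkSumC, Finset.mul_sum, Complex.re_sum]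
  refine Finset.sum_congr rfl fun s _ => ?_
  rw [← Complex.re_ofReal_mul]
  congr 1
  ring

/-- The optimal relative phase for `n + 1` qubits: `c = ((1 + i)/√2)ⁿ = e^{iπn/4}` (for three
qubits `c = i`: “`|φ⟩ = 1/√2(|000⟩ + i|111⟩)`”). [cite: AlsinaLatorre2016, §III (“the needed
GHZ-like states have relative phases”)] -/
noncomputable def optPhase (n : ℕ) : ℂ := ((1 + I) * (CHSHOpt.invSqrtTwo : ℂ)) ^ n

/-- `(1 − i)·(1/√2)·(1 + i) = √2`. [folklore] -/
private theorem star_base_mul : star ((1 + I) * (CHSHOpt.invSqrtTwo : ℂ)) * (1 + I) =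
    (Real.sqrt 2 : ℂ) := by
  have h2 : (Real.sqrt 2 : ℂ) = 2 * (CHSHOpt.invSqrtTwo : ℂ) := by
    rw [CHSHOpt.invSqrtTwo_eq]; push_cast; ring
  rw [h2, star_mul', Complex.star_def, Complex.conj_ofReal, map_add, map_one, Complex.conj_I]
  linear_combination (-(CHSHOpt.invSqrtTwo : ℂ)) * Complex.I_sq

/-- The optimal phase has modulus `1` (so `|GHZ^c⟩` is a unit vector, `ghzPhase_norm`).
[cite: AlsinaLatorre2016, §III] -/
theorem norm_optPhase (n : ℕ) : ‖optPhase n‖ = 1 := by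
  have hb : ‖(1 + I) * (CHSHOpt.invSqrtTwo : ℂ)‖ = 1 := by
    have hsq : ‖(1 + I) * (CHSHOpt.invSqrtTwo : ℂ)‖ ^ 2 = 1 := by
      rw [← Complex.normSq_eq_norm_sq, Complex.normSq_mul, Complex.normSq_ofReal,
        CHSHOpt.invSqrtTwo_mul_self, Complex.normSq_apply]
      simp
      norm_num
    nlinarith [norm_nonneg ((1 + I) * (CHSHOpt.invSqrtTwo : ℂ))]
  rw [optPhase, norm_pow, hb, one_pow]

/-- **GHZ states attain the Mermin–Klyshko quantum value `2^{(N−1)/2}`**: for `N = n + 1` qubits,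
the state `(|0…0⟩ + e^{iπn/4}|1…1⟩)/√2` measured with `σ_x / σ_y` gives
`⟨𝓑_{n+1}⟩ = (√2)ⁿ = 2^{n/2}` — Cabello's `⟨μ_n|M̂_n|μ_n⟩ = 2^{3(n−1)/2}` at `s = 1`
(`M_n = 2^{n−1}𝓑_n`), the quantum bound (2.9) of [KannoSoda2017], against the local bound `1`
of `MerminKlyshko.mermin_klyshko_inequality`. [cite: Cabello2002nSpinS, §III eq. (10);
KannoSoda2017, §2.2 eq. (2.9)] -/
theorem mk_expect_ghzOpt (n : ℕ) :
    ∑ s : Fin (n + 1) → Bool,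
        mkCoeff (n + 1) s * vecState (ghzPhase (n + 1) (optPhase n)) (obsWord s) =
      Real.sqrt 2 ^ n := by
  rw [mk_expect_ghzPhase, optPhase, star_pow, ← mul_pow, star_base_mul, ← Complex.ofReal_pow,
    Complex.ofReal_re]

/-- The quantum value exceeds the local bound `1` for every `n ≥ 1` (i.e. `N ≥ 2` qubits), by the
exponentially growing factor `(√2)ⁿ`. [cite: KannoSoda2017, §2.2 eqs. (2.8)–(2.9) (“the upper
bound can be exponentially bigger for multipartite states”)] -/
theorem one_lt_sqrt_two_pow {n : ℕ} (hn : n ≠ 0) : (1 : ℝ) < Real.sqrt 2 ^ n := by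
  refine one_lt_pow₀ ?_ hn
  rw [show (1 : ℝ) = Real.sqrt 1 from Real.sqrt_one.symm]
  exact Real.sqrt_lt_sqrt (by norm_num) (by norm_num)

/-- **Alsina–Latorre's quantum bound `⟨M₃⟩^{QM} = 4` is attained**: `M₃ = 2𝓑₃` on three qubits,
`2·(√2)² = 4`. [cite: AlsinaLatorre2016, §II (“the quantum bound, is ⟨M₃⟩^{QM} ≤ 4”)] -/
theorem alsinaLatorre_quantum_M3 :
    2 * ∑ s : Fin 3 → Bool, mkCoeff 3 s * vecState (ghzPhase 3 (optPhase 2)) (obsWord s) = 4 := by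
  rw [mk_expect_ghzOpt 2, Real.sq_sqrt (by norm_num)]; norm_num

/-- **Alsina–Latorre's quantum bound `⟨M₄⟩^{QM} = 8√2` is attained**: `M₄ = 4𝓑₄` on four qubits,
`4·(√2)³ = 8√2`. [cite: AlsinaLatorre2016, §II (“a quantum bound of ⟨M₄⟩^{QM} ≤ 8√2”)] -/
theorem alsinaLatorre_quantum_M4 :
    4 * ∑ s : Fin 4 → Bool, mkCoeff 4 s * vecState (ghzPhase 4 (optPhase 3)) (obsWord s) =
      8 * Real.sqrt 2 := by
  rw [mk_expect_ghzOpt 3, pow_succ, Real.sq_sqrt (by norm_num)]; ring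

/-- **Alsina–Latorre's quantum bound `⟨M₅⟩^{QM} = 16` is attained**: `M₅ = 4𝓑₅` on five qubits,
`4·(√2)⁴ = 16`. [cite: AlsinaLatorre2016, §II (“a quantum bound of ⟨M₅⟩^{QM} ≤ 16”)] -/
theorem alsinaLatorre_quantum_M5 :
    4 * ∑ s : Fin 5 → Bool, mkCoeff 5 s * vecState (ghzPhase 5 (optPhase 4)) (obsWord s) =
      16 := by
  rw [mk_expect_ghzOpt 4, show (4 : ℕ) = 2 * 2 from rfl, pow_mul, Real.sq_sqrt (by norm_num)]
  norm_num

end MerminKlyshkoGHZ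

end Literature.InformationTheory.Entanglement
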